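import Literature.RepresentationTheory.WeilBruhatInvariantIntegral
import HarnessLib

/-!
# The Weil–Bruhat invariant integral, II: linearity, positivity, and the invariant functional on the
# `Δ_P`-densities of a closed cocompact subgroup of a unimodular group

[WeilIntegration1965] A. Weil, *L'intégration dans les groupes topologiques et ses applications* (1940, 2nd ed. 1965), §9;
[BourbakiINT7] N. Bourbaki, *Intégration*, Chap. VII §2 n° 5–8.  Topic `RepresentationTheory`; namespace
`Literature.RepresentationTheory.WeilBruhat` (that of ★ `WeilBruhatInvariantIntegral`, whose objects `rightAverage`, `IsDensity`,
`IsBruhatFunction`, `invIntegral` and theorems `exists_isBruhatFunction`, `invIntegral_comp_mul_left_modularCharacter` this file continues).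
GROUP-AGNOSTIC, Mathlib-level; KERNEL MATHEMATICS ONLY: theorems, no definition, no named fact, no instance, no `sorry`.

Conventions are those of the ★ file: a `δ`-density is `f (x p) = δ(p)⁻¹ f x` (`p ∈ P`), `Δ_P` is Mathlib's `Measure.modularCharacter`
of `↥P` (`map (· * g) ν = Δ(g) • ν`), the invariant integral is `∮ f = invIntegral μ η f = ∫_G η f dμ` for a Bruhat function `η`.

RESULTS.
* §1 `∮` is `ℂ`-linear on continuous functions (`invIntegral_add`, `invIntegral_smul`); a Bruhat function vanishes identically on no
  coset `x₀ P` (`exists_ne_zero_of_isBruhatFunction`); **POSITIVITY** (`invIntegral_re_pos`): for a NON-NEGATIVE Bruhat function `η`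
  (they exist: ★ `exists_isBruhatFunction`), `μ` finite on compacta and positive on opens, and a continuous real-non-negative-valued
  `δ`-density `f` with `f x₀ ≠ 0` somewhere, `0 < re (∮ f)`.
* §2 **THE INVARIANT FUNCTIONAL** (`exists_leftInvariant_functional`): `G` locally compact, second countable, Hausdorff, with a Haar
  measure that is also right invariant (unimodular), `P ≤ G` closed with `G ⧸ P` compact and `Δ_P` continuous: there is
  `I : (G → ℂ) → ℂ`, additive and homogeneous on continuous functions, with `I (f (h ·)) = I f` for every continuous `Δ_P`-density `f`
  and every `h ∈ G`, and `0 < re (I f)` for every continuous real-non-negative `Δ_P`-density `f ≢ 0`.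
* §3 the MIRROR orientation (`isDensity_comp_inv`, `exists_rightInvariant_functional`): for LEFT-`P`-equivariant functions
  `f (p x) = Δ_P(p) f x` (functions on `P \ G`; the reflection `x ↦ f x⁻¹` is a `Δ_P`-density) the functional `f ↦ I (x ↦ f x⁻¹)` is
  invariant under RIGHT translations `f ↦ f (· h)`, with the same linearity and positivity.

USE (cell hodgecm-mathlib, half A line LD2, plate «(S7a) DOCK» of LD2-plan (g2); consumer B-p04 (g44) via the sequel
`GelbartRogawski1991/LocalDoubledInvariantFunctional`): with `G = U(W ⊕ −W)(L⁺_v)` (unimodular), `P = P_Δ` its Siegel parabolic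
(`G ⧸ P_Δ` compact, ★ `compactSpace_quotient_of_isSiegelDelta`), `f_Φ(h) = λ(ω(s′ h) Φ)` is continuous and left-`P_Δ`-equivariant with
character `|det_Δ|_{L_v} = Δ_{P_Δ}`, `f_{ω(g)Φ} = f_Φ(· g)`, so `Φ ↦ I(f_Φ)` of §3 is a `G`-invariant linear functional, non-zero on a spherical
`Φ` with `λ(Φ) ≠ 0` by positivity.  HONEST LABEL: pure measure theory, nothing of [Liu2021] asserted; HC_CM is proved only modulo the 7
printed citations (2 remaining: hLiu418 = stmt-HodgeConjecture-24832, h413 = stmt-HodgeConjecture-24833) until rung 0 closes; count-neutral.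

## References
* [WeilIntegration1965] A. Weil, *L'intégration dans les groupes topologiques et ses applications*, ASI 869/1145, Hermann (1940/1965), §9.
* [BourbakiINT7] N. Bourbaki, *Intégration, Chap. VII–VIII*, Chap. VII §2 n° 5–8.
* [BorelWallach2000] A. Borel, N. Wallach, *Continuous cohomology, discrete subgroups, and representations of reductive groups*, I §1.
-/

set_option autoImplicit false

noncomputable section

open MeasureTheory
open scoped NNReal

namespace Literature.RepresentationTheory.WeilBruhat

variable {G : Type*} [Group G] [TopologicalSpace G] [IsTopologicalGroup G] [MeasurableSpace G] [BorelSpace G]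
  (P : Subgroup G) (ν : Measure P) (δ : P →* ℝ≥0)

/-! ## §1 Linearity and positivity of the invariant integral `∮ f = ∫_G η f dμ` -/

omit [Group G] [TopologicalSpace G] [IsTopologicalGroup G] [BorelSpace G] in
/-- `∮ (a • f) = a · ∮ f` (for every `f`). [cite: WeilIntegration1965, §9] -/
theorem invIntegral_smul (μ : Measure G) (η : G → ℂ) (a : ℂ) (f : G → ℂ) :
    invIntegral μ η (a • f) = a * invIntegral μ η f := by
  unfold invIntegral
  rw [← integral_const_mul]
  refine integral_congr_ae (Filter.Eventually.of_forall fun x => ?_)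
  simp only [Pi.smul_apply, smul_eq_mul]
  ring

omit [Group G] [IsTopologicalGroup G] in
/-- `∮ (f + g) = ∮ f + ∮ g` for continuous `f, g` when `η ∈ C_c(G)` and `μ` is finite on compacta. [cite: WeilIntegration1965, §9] -/
theorem invIntegral_add (μ : Measure G) [IsFiniteMeasureOnCompacts μ] {η : G → ℂ} (hη : Continuous η)
    (h'η : HasCompactSupport η) {f g : G → ℂ} (hf : Continuous f) (hg : Continuous g) :
    invIntegral μ η (f + g) = invIntegral μ η f + invIntegral μ η g := by
  have hi : ∀ {k : G → ℂ}, Continuous k → Integrable (fun x => η x * k x) μ := fun {k} hk =>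
    (hη.mul hk).integrable_of_hasCompactSupport (h'η.mul_right (f' := k))
  unfold invIntegral
  rw [← integral_add (hi hf) (hi hg)]
  refine integral_congr_ae (Filter.Eventually.of_forall fun x => ?_)
  simp only [Pi.add_apply, mul_add]

omit [IsTopologicalGroup G] [BorelSpace G] in
/-- a Bruhat function vanishes identically on no coset `x₀ P` (because `A_P η x₀ = 1`). [cite: BourbakiINT7, Ch. VII §2] -/
theorem exists_ne_zero_of_isBruhatFunction {η : G → ℂ} (hη : IsBruhatFunction P ν η) (x₀ : G) :
    ∃ p : P, η (x₀ * (p : G)) ≠ 0 := by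
  by_contra h
  push Not at h
  have h1 := hη.2.2 x₀
  have h2 : rightAverage P ν η x₀ = 0 := by
    unfold rightAverage
    simp only [h, integral_zero]
  rw [h2] at h1
  exact zero_ne_one h1

omit [IsTopologicalGroup G] in
/-- **POSITIVITY OF THE INVARIANT INTEGRAL**: for a non-negative Bruhat function `η₀` (★ `exists_isBruhatFunction`), `μ` finite on
compacta and positive on opens, and a continuous `δ`-density `f` with real non-negative values and `f x₀ ≠ 0` somewhere, `0 < re (∮ f)`
(`f (x₀ p) = δ(p)⁻¹ f x₀ ≠ 0` for all `p`, and `η₀ (x₀ p) ≠ 0` for some `p`; the integrand `η₀ · f ≥ 0` is continuous, compactly supported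
and not identically zero). [cite: WeilIntegration1965, §9] [cite: BourbakiINT7, Ch. VII §2] -/
theorem invIntegral_re_pos (μ : Measure G) [IsFiniteMeasureOnCompacts μ] [μ.IsOpenPosMeasure]
    {η₀ : G → ℝ} (hη₀ : 0 ≤ η₀) (hη : IsBruhatFunction P ν fun x => (η₀ x : ℂ))
    {f : G → ℂ} (hf : Continuous f) (hfd : IsDensity P δ f) (hf0 : ∀ x, f x = ((f x).re : ℂ) ∧ 0 ≤ (f x).re)
    {x₀ : G} (hx₀ : f x₀ ≠ 0) :
    0 < (invIntegral μ (fun x => (η₀ x : ℂ)) f).re := by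
  obtain ⟨p, hp⟩ := exists_ne_zero_of_isBruhatFunction P ν hη x₀
  have hη₀c : Continuous η₀ := by
    have h := Complex.continuous_re.comp hη.1
    simpa only [Function.comp_def, Complex.ofReal_re] using h
  have hη₀s : HasCompactSupport η₀ := by
    have h : HasCompactSupport fun x => ((η₀ x : ℂ)).re := hη.2.1.comp_left Complex.zero_re
    simpa only [Complex.ofReal_re] using h
  have hint : invIntegral μ (fun x => (η₀ x : ℂ)) f = ((∫ x, η₀ x * (f x).re ∂μ : ℝ) : ℂ) := by
    have e : (fun x => (η₀ x : ℂ) * f x) = fun x => ((η₀ x * (f x).re : ℝ) : ℂ) :=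
      funext fun x => by rw [Complex.ofReal_mul, ← (hf0 x).1]
    unfold invIntegral
    rw [e]
    exact integral_ofReal
  rw [hint, Complex.ofReal_re]
  refine Continuous.integral_pos_of_hasCompactSupport_nonneg_nonzero (hη₀c.mul (Complex.continuous_re.comp hf))
    (hη₀s.mul_right (f' := fun x => (f x).re)) (fun x => mul_nonneg (hη₀ x) (hf0 x).2) (x := x₀ * (p : G)) ?_
  have h1 : η₀ (x₀ * (p : G)) ≠ 0 := fun h => hp (by rw [h, Complex.ofReal_zero])
  have h2 : (f (x₀ * (p : G))).re ≠ 0 := by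
    intro h
    have h3 : f (x₀ * (p : G)) = 0 := by rw [(hf0 _).1, h, Complex.ofReal_zero]
    rw [hfd x₀ p] at h3
    have hδ0 : ((δ p : ℝ) : ℂ) ≠ 0 := by
      have h4 : δ p * δ p⁻¹ = 1 := by rw [← map_mul, mul_inv_cancel, map_one]
      exact_mod_cast left_ne_zero_of_mul_eq_one h4
    exact hx₀ ((mul_eq_zero.1 h3).resolve_left (inv_ne_zero hδ0))
  exact mul_ne_zero h1 h2

/-! ## §2 The invariant functional on the continuous `Δ_P`-densities of a closed cocompact `P` in a unimodular `G` -/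

/-- **THE WEIL–BRUHAT INVARIANT FUNCTIONAL**: `G` locally compact, second countable, Hausdorff, `μ` a Haar measure on `G` that is also
right invariant (`G` unimodular), `P ≤ G` closed (hence locally compact) with `G ⧸ P` compact and `Δ_P` (Mathlib's `modularCharacter` of
`↥P`) continuous.  Then there is `I : (G → ℂ) → ℂ` — namely `I f = ∫_G η₀ f dμ` for a non-negative Bruhat function `η₀` of
`(G, P, Haar of ↥P)` — which is additive and homogeneous on continuous functions, LEFT-INVARIANT `I (f (h ·)) = I f` on every continuous
`Δ_P`-density `f` (`f (x p) = Δ_P(p)⁻¹ f x`), and POSITIVE: `0 < re (I f)` for every continuous `Δ_P`-density `f` with real non-negative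
values and `f x₀ ≠ 0` somewhere. [cite: WeilIntegration1965, §9] [cite: BourbakiINT7, Ch. VII §2] -/
theorem exists_leftInvariant_functional [LocallyCompactSpace G] [SecondCountableTopology G] [T2Space G]
    (μ : Measure G) [μ.IsHaarMeasure] [μ.IsMulRightInvariant] (hP : IsClosed (P : Set G)) [LocallyCompactSpace P]
    [CompactSpace (G ⧸ P)] (hΔ : Continuous (Measure.modularCharacter : P → ℝ≥0)) :
    ∃ I : (G → ℂ) → ℂ,
      (∀ f g : G → ℂ, Continuous f → Continuous g → I (f + g) = I f + I g) ∧
      (∀ (a : ℂ) (f : G → ℂ), I (a • f) = a * I f) ∧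
      (∀ f : G → ℂ, Continuous f → IsDensity P Measure.modularCharacter f → ∀ h : G, I (fun x => f (h * x)) = I f) ∧
      (∀ f : G → ℂ, Continuous f → IsDensity P Measure.modularCharacter f →
        (∀ x, f x = ((f x).re : ℂ) ∧ 0 ≤ (f x).re) → ∀ x₀ : G, f x₀ ≠ 0 → 0 < (I f).re) := by
  haveI : SecondCountableTopology P := inferInstanceAs (SecondCountableTopology (P : Set G))
  set ν₀ : Measure P := Measure.haar
  obtain ⟨η₀, -, -, hη₀, hη⟩ := exists_isBruhatFunction P ν₀ hP
  exact ⟨invIntegral μ fun x => (η₀ x : ℂ), fun f g hf hg => invIntegral_add μ hη.1 hη.2.1 hf hg,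
    fun a f => invIntegral_smul μ _ a f,
    fun f hf hfd h => invIntegral_comp_mul_left_modularCharacter P ν₀ μ hP hΔ hη hf hfd h,
    fun f hf hfd hf0 x₀ hx₀ => invIntegral_re_pos P ν₀ Measure.modularCharacter μ hη₀ hη hf hfd hf0 hx₀⟩

/-! ## §3 The mirror orientation: left-`P`-equivariant functions and right translations -/

omit [TopologicalSpace G] [IsTopologicalGroup G] [MeasurableSpace G] [BorelSpace G] in
/-- the reflection `x ↦ f x⁻¹` of a LEFT-`δ`-EQUIVARIANT function (`f (p x) = δ(p) f x`, a function on `P \ G` twisted by `δ`) is a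
`δ`-density (`F (x p) = δ(p)⁻¹ F x`). [cite: WeilIntegration1965, §9] -/
theorem isDensity_comp_inv {f : G → ℂ} (hf : ∀ (p : P) (x : G), f ((p : G) * x) = ((δ p : ℝ) : ℂ) * f x) :
    IsDensity P δ fun x => f x⁻¹ := by
  intro x p
  simp only [mul_inv_rev]
  rw [← Subgroup.coe_inv, hf p⁻¹ x⁻¹, map_inv, NNReal.coe_inv, Complex.ofReal_inv]

/-- **THE INVARIANT FUNCTIONAL, MIRROR ORIENTATION** (same hypotheses as `exists_leftInvariant_functional`): there is
`I : (G → ℂ) → ℂ` (namely `f ↦ ∫_G η₀(x) f(x⁻¹) dμ`), additive and homogeneous on continuous functions, RIGHT-INVARIANT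
`I (f (· h)) = I f` on every continuous LEFT-`Δ_P`-EQUIVARIANT `f` (`f (p x) = Δ_P(p) f x` for `p ∈ P` — functions on `P \ G` twisted by
`Δ_P`), and POSITIVE: `0 < re (I f)` for every such `f` with real non-negative values and `f x₀ ≠ 0` somewhere.  This is the orientation of
matrix coefficients `h ↦ λ(π(h) v)` of a `P`-eigenfunctional `λ`. [cite: WeilIntegration1965, §9] [cite: BourbakiINT7, Ch. VII §2] -/
theorem exists_rightInvariant_functional [LocallyCompactSpace G] [SecondCountableTopology G] [T2Space G]
    (μ : Measure G) [μ.IsHaarMeasure] [μ.IsMulRightInvariant] (hP : IsClosed (P : Set G)) [LocallyCompactSpace P]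
    [CompactSpace (G ⧸ P)] (hΔ : Continuous (Measure.modularCharacter : P → ℝ≥0)) :
    ∃ I : (G → ℂ) → ℂ,
      (∀ f g : G → ℂ, Continuous f → Continuous g → I (f + g) = I f + I g) ∧
      (∀ (a : ℂ) (f : G → ℂ), I (a • f) = a * I f) ∧
      (∀ f : G → ℂ, Continuous f →
        (∀ (p : P) (x : G), f ((p : G) * x) = ((Measure.modularCharacter p : ℝ) : ℂ) * f x) →
        ∀ h : G, I (fun x => f (x * h)) = I f) ∧
      (∀ f : G → ℂ, Continuous f →
        (∀ (p : P) (x : G), f ((p : G) * x) = ((Measure.modularCharacter p : ℝ) : ℂ) * f x) →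
        (∀ x, f x = ((f x).re : ℂ) ∧ 0 ≤ (f x).re) → ∀ x₀ : G, f x₀ ≠ 0 → 0 < (I f).re) := by
  obtain ⟨I₀, hadd, hsmul, hinv, hpos⟩ := exists_leftInvariant_functional P μ hP hΔ
  refine ⟨fun f => I₀ fun x => f x⁻¹, fun f g hf hg => ?_, fun a f => hsmul a _, fun f hf hfl h => ?_,
    fun f hf hfl hf0 x₀ hx₀ => ?_⟩
  · exact hadd _ _ (hf.comp continuous_inv) (hg.comp continuous_inv)
  · have e := hinv (fun x => f x⁻¹) (hf.comp continuous_inv) (isDensity_comp_inv P Measure.modularCharacter hfl) h⁻¹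
    simpa only [mul_inv_rev, inv_inv] using e
  · exact hpos _ (hf.comp continuous_inv) (isDensity_comp_inv P Measure.modularCharacter hfl) (fun x => hf0 x⁻¹) x₀⁻¹
      (by simpa only [inv_inv] using hx₀)

end Literature.RepresentationTheory.WeilBruhat

end
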